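import Summits.CriticalPhenomena.SAWScalingLimit.Theses.SAWPoissonBanks

/-!
# Line `birth` — registered skeleton for the crux `PoissonRigidity` (stmt-CriticalPhenomena-4777)

Crux (FIXED; rank 3 of `route-CriticalPhenomena-SAWPoissonBanks`, decl
`Summit.CriticalPhenomena.SAWScalingLimit.Theses.SAWPoissonBanks.PoissonRigidity`): every chordal family `P`
with two-sided restriction, a restriction-coupled domain-Markov kernel, reversibility, covariance under the
lattice similarities `z ↦ r·iᵏ·z + w` and under conjugation, carried by simple boundary-avoiding curves, AND
whose banks on both sides satisfy Matheron's complete-alternation tower in every Dobrushin domain, is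
conformally covariant (`ChordalFamily.IsConformallyCovariant`).

This file is the route header's own foreseen cut "PoissonRigidity ⇐ GeneratorForm → GeneratorRigidity",
with the measure-theoretic tail made explicit, written as THREE registered stubs and a kernel-checked
composition `PoissonRigidity_of` concluding the crux BY NAME:

* S1 `stub_poissonGenerator` — GENERATOR FORM (Matheron–Choquet–Kendall on the semilattice of hulls hanging
  off one arc; Molchanov, *Theory of Random Sets* (2017) Ch. 4 Thm 1.6 "union-infinitely-divisible ⟺
  `T = 1 − exp(−Ψ)`, `Ψ` completely alternating"; Berg–Christensen–Ressel Ch. 4 for the semigroup form):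
  a chordal family carried by simple boundary-avoiding curves whose one-sided hull-avoidance probabilities
  satisfy the alternation tower admits, for every domain `D` and side `j`, a GERM MEASURE `ν D j` — a Borel
  measure on closed subsets of the plane (Hausdorff = myope topology on the compact `cl D`) — with
  `P D {γ ⊆ ⋂ᵢ cl Fᵢ} = exp (−ν D j {K | K ⊄ ⋂ᵢ cl Fᵢ})` for every finite family of hull-complements `Fᵢ`
  of `D` on side `j` ("the bank is the fill of a Poisson germ process of intensity `ν D j`"). The value
  `ν = ⊤` is allowed (`EReal.exp ⊥ = 0`), so null avoidance events need no side condition. The converse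
  (such a representation ⇒ the tower) is the easy direction of Matheron's theorem, so S1 loses nothing.
  Known theory, not in Mathlib (no Choquet capacity theorem): size L–XL.
* S2 `stub_generatorRigidity` — GENERATOR RIGIDITY (the conjectural core; the crux's hypotheses with the
  tower REPLACED by its generator form, and a SCALAR conclusion): a chordal restriction family with the
  restriction-coupled Markov kernel, reversibility, lattice-similarity and conjugation covariance, simple
  boundary-avoiding curves and Poisson germ measures on both sides has CONFORMALLY INVARIANT SQUEEZE-AVOIDANCE
  PROBABILITIES: for every conformal equivalence `g : D → D'` with boundary values `a ↦ a'`, `b ↦ b'` and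
  every Dobrushin `B' ⊆ D'` with the same marked points agreeing with `D'` near `a'`, `b'`,
  `P D' {γ ⊆ cl B'} = P D {γ ∩ D ⊆ g⁻¹(cl B' ∩ D')}` (pull-back by SETS, so no boundary extension of `g` is
  presupposed). Intended attack (route header, TWO-LAYER PLAN): restriction = Poisson thinning of ONE
  generator; two-sidedness = self-consistency of the generator under swallowing; dilations/translations/D4
  act on `ν`; the answer `ν D j = (5/8)·μ^{exc}_{D, arc j}` (Werner 2005 Thm 8) is conformally invariant;
  two-sided squeezes factor through one-sided ones by restriction. Size: open problem (as the crux).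
* S3 `stub_squeezeCovariance` — SQUEEZE-AVOIDANCE INVARIANCE ⇒ CONFORMAL COVARIANCE (measure transport +
  the tree theorem `AvoidanceDeterminesLaw_proof`, LSW03 Lemma 3.2 for simple chords of a Jordan domain,
  PROVED in `Theorems/SAWLoopFugacityFlowAvoidanceDeterminesLaw.lean`): for `P` chordal on simple
  boundary-avoiding curves, squeeze invariance gives `P D' = Φ_* (P D)` for every continuous `Φ` agreeing
  with `g` on `D` — both sides are probability laws on simple chords of `D'` meeting `∂D'` only at `a', b'`
  (`Φ a = a'`, `Φ b = b'` from the boundary values; `Φ` is injective on `D ∪ {a, b}`), and they agree on every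
  squeeze event because `Φ ∘ γ ⊆ cl B' ⟺ range γ ∩ D ⊆ g⁻¹(cl B' ∩ D')` for boundary-avoiding `γ`. Size M.

`PoissonRigidity_of` feeds the crux's tower to S1, the generator to S2, the invariance to S3. Each stub is
stated over TREE VOCABULARY ONLY (Mathlib + `Literature.Probability.RandomPlanarGeometry`), so it lands
verbatim as `Theorems/SAWPoissonBanksPoissonRigidity<Stub>.lean --supports stmt-CriticalPhenomena-4777`; the
named statements of §Vocabulary are definitionally the stubs (`*_iff` below are `Iff.rfl`).

Disproof used: none exists for this crux (`ledger crux ls stmt-CriticalPhenomena-4777`: no workfiles,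
2026-08-17). Negatives index (11 entries) checked: the only symmetry-upgrade refutation
(`not_SymmetryUpgrade`, stmt-0698, fat-germ surgery of SLE₆) needs the ABSENCE of restriction; S2 keeps
two-sided restriction, the restriction-coupled kernel and reversibility (refuter note 2026-08-15: germ
classes are not independent under these), and S1/S3 are consequences of known theorems.
-/

noncomputable section

open MeasureTheory Filter Topology Set
open Literature.Probability.RandomPlanarGeometry

namespace Summit.CriticalPhenomena.SAWScalingLimit.Cruxes.PoissonRigidity.Birth

/-! ### Vocabulary of the line (named statements; the stubs below are their hand-unfolded forms) -/

/-- `B` is a HULL-COMPLEMENT of `D` on side `j`: a Dobrushin sub-domain with the same marked points, the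
arc `D.arc j` kept in its frontier (the removed hulls hang off the opposite arc), agreeing with `D` near
both marked points — literally the five-clause condition inlined in the crux. -/
def IsHullComplement (D : DobrushinDomain) (j : Fin 2) (B : DobrushinDomain) : Prop :=
  B.carrier ⊆ D.carrier ∧ B.pt 0 = D.pt 0 ∧ B.pt 1 = D.pt 1 ∧ D.arc j ⊆ frontier B.carrier ∧
    (∃ ε : ℝ, 0 < ε ∧ B.carrier ∩ Metric.ball (D.pt 0) ε = D.carrier ∩ Metric.ball (D.pt 0) ε ∧
      B.carrier ∩ Metric.ball (D.pt 1) ε = D.carrier ∩ Metric.ball (D.pt 1) ε)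

/-- `B'` is a (two-sided) SQUEEZE of `D'`: a Dobrushin sub-domain with the same marked points agreeing
with `D'` near both of them — literally the test class of `AvoidanceDeterminesLaw`. -/
def IsSqueeze (D' B' : DobrushinDomain) : Prop :=
  B'.carrier ⊆ D'.carrier ∧ B'.pt 0 = D'.pt 0 ∧ B'.pt 1 = D'.pt 1 ∧
    (∃ ε : ℝ, 0 < ε ∧ B'.carrier ∩ Metric.ball (D'.pt 0) ε = D'.carrier ∩ Metric.ball (D'.pt 0) ε ∧
      B'.carrier ∩ Metric.ball (D'.pt 1) ε = D'.carrier ∩ Metric.ball (D'.pt 1) ε)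

/-- The curves of `P` are simple and meet `∂D` only at the marked points (crux hypothesis (vii)). -/
def SimpleBoundaryAvoiding (P : ChordalFamily) : Prop :=
  ∀ D : DobrushinDomain, ∀ᵐ γ ∂(P D),
    γ ∈ CurveClass.simple ∧ γ.range ∩ frontier D.carrier ⊆ {D.pt 0, D.pt 1}

/-- The restriction-coupled domain-Markov kernel (crux hypothesis (iii), verbatim). -/
def MarkovCoupled (P : ChordalFamily) : Prop :=
  ∃ Q : DobrushinDomain → CurveClass ℂ → Measure (CurveClass ℂ), P.IsMarkovExtension Q ∧
    ∀ (D : DobrushinDomain) (p : CurveClass ℂ) (D' : DobrushinDomain),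
      D'.carrier ⊆ remainingDomain D p → D'.pt 0 = p.target → D'.pt 1 = D.pt 1 →
        ∀ T : Set (CurveClass ℂ), MeasurableSet T →
          P D' T * Q D p (CurveClass.rangeSubset (closure D'.carrier)) =
            Q D p (T ∩ CurveClass.rangeSubset (closure D'.carrier))

/-- Reversibility (crux hypothesis (iv), verbatim). -/
def Reversible (P : ChordalFamily) : Prop :=
  ∀ D D' : DobrushinDomain, D'.carrier = D.carrier → D'.pt 0 = D.pt 1 → D'.pt 1 = D.pt 0 →
    P D' = (P D).map CurveClass.reverse

/-- Covariance under the lattice similarities `z ↦ r·iᵏ·z + w` (crux hypothesis (v), verbatim). -/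
def LatticeSimilarityCovariant (P : ChordalFamily) : Prop :=
  ∀ (D : DobrushinDomain) (c : ℂ) (hc : c ≠ 0) (w : ℂ), (∃ (r : ℝ) (k : ℕ), 0 < r ∧ c = (r : ℂ) * Complex.I ^ k) →
    P (D.map (similarity c hc w)) = (P D).map (CurveClass.map (similarity c hc w : C(ℂ, ℂ)))

/-- Covariance under complex conjugation (crux hypothesis (vi), verbatim). -/
def ConjugationCovariant (P : ChordalFamily) : Prop :=
  ∀ D : DobrushinDomain, P (D.map Complex.conjLIE.toHomeomorph) =
    (P D).map (CurveClass.map (Complex.conjLIE.toHomeomorph : C(ℂ, ℂ)))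

/-- Matheron's complete-alternation tower of the banks on both sides (crux hypothesis (viii), verbatim
up to the name `IsHullComplement`). -/
def AlternationTower (P : ChordalFamily) : Prop :=
  ∀ (D : DobrushinDomain) (j : Fin 2) (B : DobrushinDomain) (n : ℕ) (F : Fin (n + 1) → DobrushinDomain),
    IsHullComplement D j B → (∀ i, IsHullComplement D j (F i)) →
      (∏ S ∈ (Finset.univ : Finset (Finset (Fin (n + 1)))).filter (fun S => Odd S.card),
          P D (CurveClass.rangeSubset (closure B.carrier) ∩
            ⋂ i ∈ S, CurveClass.rangeSubset (closure (F i).carrier))) ≤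
        ∏ S ∈ (Finset.univ : Finset (Finset (Fin (n + 1)))).filter (fun S => Even S.card),
          P D (CurveClass.rangeSubset (closure B.carrier) ∩
            ⋂ i ∈ S, CurveClass.rangeSubset (closure (F i).carrier))

/-- GERM MEASURES: Borel measures on the closed subsets of the plane (Hausdorff-distance topology; on the
compact `cl D` this is the myope topology, whose Borel σ-algebra is Matheron's Effros σ-algebra). -/
abbrev GermMeasure : Type :=
  @Measure (TopologicalSpace.Closeds ℂ) (borel (TopologicalSpace.Closeds ℂ))

/-- `ν` is a POISSON GENERATOR of the banks of `P`: for every domain `D`, side `j` and finite family of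
hull-complements `Fᵢ` of `D` on side `j`, the probability that the curve stays in `⋂ᵢ cl Fᵢ` is
`exp (−ν D j {germs not contained in ⋂ᵢ cl Fᵢ})` — the avoidance functional of the side-`j` bank is that
of the union of a Poisson process of closed germs with intensity `ν D j` (`ν = ⊤` allowed: `exp ⊥ = 0`). -/
def IsPoissonGenerator (P : ChordalFamily) (ν : DobrushinDomain → Fin 2 → GermMeasure) : Prop :=
  ∀ (D : DobrushinDomain) (j : Fin 2) (n : ℕ) (F : Fin (n + 1) → DobrushinDomain),
    (∀ i, IsHullComplement D j (F i)) →
      P D (⋂ i, CurveClass.rangeSubset (closure (F i).carrier)) =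
        EReal.exp (-((ν D j {K | ¬ ((K : Set ℂ) ⊆ ⋂ i, closure (F i).carrier)} : ENNReal) : EReal))

/-- SQUEEZE-AVOIDANCE INVARIANCE of `P` under conformal equivalences of Dobrushin domains, in pull-back
form: for `g : D → D'` conformal with boundary values `a ↦ a'`, `b ↦ b'` and every squeeze `B'` of `D'`,
`P D' {γ ⊆ cl B'} = P D {range γ ∩ D ⊆ g⁻¹ (cl B' ∩ D')}`. -/
def SqueezeInvariant (P : ChordalFamily) : Prop :=
  ∀ (D D' : DobrushinDomain) (g : ConformalEquiv D.carrier D'.carrier),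
    g.HasBoundaryValue (D.pt 0) (D'.pt 0) → g.HasBoundaryValue (D.pt 1) (D'.pt 1) →
      ∀ B' : DobrushinDomain, IsSqueeze D' B' →
        P D' (CurveClass.rangeSubset (closure B'.carrier)) =
          P D {γ | γ.range ∩ D.carrier ⊆ g.symm '' (closure B'.carrier ∩ D'.carrier)}

/-- **S1, named.** Generator form of the banks. -/
def PoissonGeneratorForm : Prop :=
  ∀ P : ChordalFamily, P.IsChordal → SimpleBoundaryAvoiding P → AlternationTower P →
    ∃ ν : DobrushinDomain → Fin 2 → GermMeasure, IsPoissonGenerator P ν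

/-- **S2, named.** Generator rigidity. -/
def GeneratorRigidity : Prop :=
  ∀ P : ChordalFamily, P.IsChordal → P.IsRestriction → MarkovCoupled P → Reversible P →
    LatticeSimilarityCovariant P → ConjugationCovariant P → SimpleBoundaryAvoiding P →
      (∃ ν : DobrushinDomain → Fin 2 → GermMeasure, IsPoissonGenerator P ν) → SqueezeInvariant P

/-- **S3, named.** Squeeze-avoidance invariance gives conformal covariance. -/
def SqueezeCovariance : Prop :=
  ∀ P : ChordalFamily, P.IsChordal → SimpleBoundaryAvoiding P → SqueezeInvariant P →
    P.IsConformallyCovariant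

/-! ### The stubs (the ONLY `sorry`s of this file), in tree vocabulary -/

/-- **S1 — Poisson generator of the banks (Matheron–Choquet–Kendall on the hull semilattice).** For a
chordal family carried by simple boundary-avoiding curves, the complete-alternation tower of the one-sided
hull-avoidance probabilities (all domains, both sides, all finite families) yields, per domain and side, a
Borel germ measure `ν D j` on closed subsets of the plane with
`P D {γ ⊆ ⋂ᵢ cl Fᵢ} = exp (−ν D j {K | K ⊄ ⋂ᵢ cl Fᵢ})` for every finite family of hull-complements on that
side. Content: `Ψ = −log P D {γ ⊆ ·}` is completely alternating on the ∪-semigroup of finite unions of open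
hulls `cl D ∖ cl F` (this IS the tower), continuous along exhaustions (σ-additivity of `P D`), finite on
small bumps (boundary avoidance); represent it by a Radon measure on semicharacters (Berg–Christensen–Ressel
4.3) and realise ν-almost every semicharacter as the closed germ `cl D ∖ ⋃ {avoided hulls}` (Matheron,
Molchanov 2017 Ch. 4 Thm 1.6; Ch. 1 §1.4). `ν = ⊤` on a hull is allowed (`EReal.exp ⊥ = 0`). -/
theorem stub_poissonGenerator :
    ∀ P : ChordalFamily, P.IsChordal →
      (∀ D : DobrushinDomain, ∀ᵐ γ ∂(P D),
        γ ∈ CurveClass.simple ∧ γ.range ∩ frontier D.carrier ⊆ {D.pt 0, D.pt 1}) →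
      (∀ (D : DobrushinDomain) (j : Fin 2) (B : DobrushinDomain) (n : ℕ)
          (F : Fin (n + 1) → DobrushinDomain),
        (B.carrier ⊆ D.carrier ∧ B.pt 0 = D.pt 0 ∧ B.pt 1 = D.pt 1 ∧ D.arc j ⊆ frontier B.carrier ∧
          (∃ ε : ℝ, 0 < ε ∧ B.carrier ∩ Metric.ball (D.pt 0) ε = D.carrier ∩ Metric.ball (D.pt 0) ε ∧
            B.carrier ∩ Metric.ball (D.pt 1) ε = D.carrier ∩ Metric.ball (D.pt 1) ε)) →
        (∀ i, ((F i).carrier ⊆ D.carrier ∧ (F i).pt 0 = D.pt 0 ∧ (F i).pt 1 = D.pt 1 ∧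
          D.arc j ⊆ frontier (F i).carrier ∧
          (∃ ε : ℝ, 0 < ε ∧ (F i).carrier ∩ Metric.ball (D.pt 0) ε = D.carrier ∩ Metric.ball (D.pt 0) ε ∧
            (F i).carrier ∩ Metric.ball (D.pt 1) ε = D.carrier ∩ Metric.ball (D.pt 1) ε))) →
        (∏ S ∈ (Finset.univ : Finset (Finset (Fin (n + 1)))).filter (fun S => Odd S.card),
            P D (CurveClass.rangeSubset (closure B.carrier) ∩
              ⋂ i ∈ S, CurveClass.rangeSubset (closure (F i).carrier))) ≤
          ∏ S ∈ (Finset.univ : Finset (Finset (Fin (n + 1)))).filter (fun S => Even S.card),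
            P D (CurveClass.rangeSubset (closure B.carrier) ∩
              ⋂ i ∈ S, CurveClass.rangeSubset (closure (F i).carrier))) →
      ∃ ν : DobrushinDomain → Fin 2 →
          @Measure (TopologicalSpace.Closeds ℂ) (borel (TopologicalSpace.Closeds ℂ)),
        ∀ (D : DobrushinDomain) (j : Fin 2) (n : ℕ) (F : Fin (n + 1) → DobrushinDomain),
          (∀ i, ((F i).carrier ⊆ D.carrier ∧ (F i).pt 0 = D.pt 0 ∧ (F i).pt 1 = D.pt 1 ∧
            D.arc j ⊆ frontier (F i).carrier ∧
            (∃ ε : ℝ, 0 < ε ∧ (F i).carrier ∩ Metric.ball (D.pt 0) ε = D.carrier ∩ Metric.ball (D.pt 0) ε ∧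
              (F i).carrier ∩ Metric.ball (D.pt 1) ε = D.carrier ∩ Metric.ball (D.pt 1) ε))) →
          P D (⋂ i, CurveClass.rangeSubset (closure (F i).carrier)) =
            EReal.exp (-((ν D j {K | ¬ ((K : Set ℂ) ⊆ ⋂ i, closure (F i).carrier)} : ENNReal) : EReal)) := by
  sorry

/-- **S2 — generator rigidity (the conjectural core of the line).** A chordal family with two-sided
restriction, the restriction-coupled domain-Markov kernel, reversibility, covariance under `z ↦ r·iᵏ·z + w`
and conjugation, carried by simple boundary-avoiding curves, whose banks on BOTH sides are Poisson germ
fills (a generator `ν` as in S1), has conformally invariant squeeze-avoidance probabilities in pull-back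
form: for every conformal equivalence `g : D → D'` of Dobrushin domains with boundary values `a ↦ a'`,
`b ↦ b'` and every squeeze `B'` of `D'` (same marked points, agreeing with `D'` near them),
`P D' {γ ⊆ cl B'} = P D {range γ ∩ D ⊆ g⁻¹(cl B' ∩ D')}`. Why plausibly true: the expected unique such
family is chordal SLE_{8/3} (generator `(5/8)·μ^{exc}`, Werner 2005 Thm 8), for which this is conformal
invariance of SLE; the generator turns restriction into Poisson THINNING of one σ-additive object and
two-sidedness into its self-consistency under swallowing, on which dilations, translations and the
quarter-turn act — the route's bet. A counterexample is a new barrier (route KILL CRITERIA). -/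
theorem stub_generatorRigidity :
    ∀ P : ChordalFamily, P.IsChordal → P.IsRestriction →
      (∃ Q : DobrushinDomain → CurveClass ℂ → Measure (CurveClass ℂ), P.IsMarkovExtension Q ∧
        ∀ (D : DobrushinDomain) (p : CurveClass ℂ) (D' : DobrushinDomain),
          D'.carrier ⊆ remainingDomain D p → D'.pt 0 = p.target → D'.pt 1 = D.pt 1 →
            ∀ T : Set (CurveClass ℂ), MeasurableSet T →
              P D' T * Q D p (CurveClass.rangeSubset (closure D'.carrier)) =
                Q D p (T ∩ CurveClass.rangeSubset (closure D'.carrier))) →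
      (∀ D D' : DobrushinDomain, D'.carrier = D.carrier → D'.pt 0 = D.pt 1 → D'.pt 1 = D.pt 0 →
        P D' = (P D).map CurveClass.reverse) →
      (∀ (D : DobrushinDomain) (c : ℂ) (hc : c ≠ 0) (w : ℂ),
        (∃ (r : ℝ) (k : ℕ), 0 < r ∧ c = (r : ℂ) * Complex.I ^ k) →
          P (D.map (similarity c hc w)) = (P D).map (CurveClass.map (similarity c hc w : C(ℂ, ℂ)))) →
      (∀ D : DobrushinDomain, P (D.map Complex.conjLIE.toHomeomorph) =
        (P D).map (CurveClass.map (Complex.conjLIE.toHomeomorph : C(ℂ, ℂ)))) →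
      (∀ D : DobrushinDomain, ∀ᵐ γ ∂(P D),
        γ ∈ CurveClass.simple ∧ γ.range ∩ frontier D.carrier ⊆ {D.pt 0, D.pt 1}) →
      (∃ ν : DobrushinDomain → Fin 2 →
          @Measure (TopologicalSpace.Closeds ℂ) (borel (TopologicalSpace.Closeds ℂ)),
        ∀ (D : DobrushinDomain) (j : Fin 2) (n : ℕ) (F : Fin (n + 1) → DobrushinDomain),
          (∀ i, ((F i).carrier ⊆ D.carrier ∧ (F i).pt 0 = D.pt 0 ∧ (F i).pt 1 = D.pt 1 ∧
            D.arc j ⊆ frontier (F i).carrier ∧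
            (∃ ε : ℝ, 0 < ε ∧ (F i).carrier ∩ Metric.ball (D.pt 0) ε = D.carrier ∩ Metric.ball (D.pt 0) ε ∧
              (F i).carrier ∩ Metric.ball (D.pt 1) ε = D.carrier ∩ Metric.ball (D.pt 1) ε))) →
          P D (⋂ i, CurveClass.rangeSubset (closure (F i).carrier)) =
            EReal.exp (-((ν D j {K | ¬ ((K : Set ℂ) ⊆ ⋂ i, closure (F i).carrier)} : ENNReal) : EReal))) →
      ∀ (D D' : DobrushinDomain) (g : ConformalEquiv D.carrier D'.carrier),
        g.HasBoundaryValue (D.pt 0) (D'.pt 0) → g.HasBoundaryValue (D.pt 1) (D'.pt 1) →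
          ∀ B' : DobrushinDomain, (B'.carrier ⊆ D'.carrier ∧ B'.pt 0 = D'.pt 0 ∧ B'.pt 1 = D'.pt 1 ∧
            (∃ ε : ℝ, 0 < ε ∧ B'.carrier ∩ Metric.ball (D'.pt 0) ε = D'.carrier ∩ Metric.ball (D'.pt 0) ε ∧
              B'.carrier ∩ Metric.ball (D'.pt 1) ε = D'.carrier ∩ Metric.ball (D'.pt 1) ε)) →
            P D' (CurveClass.rangeSubset (closure B'.carrier)) =
              P D {γ | γ.range ∩ D.carrier ⊆ g.symm '' (closure B'.carrier ∩ D'.carrier)} := by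
  sorry

/-- **S3 — squeeze-avoidance invariance gives conformal covariance.** For `P` chordal on simple
boundary-avoiding curves, pull-back invariance of the squeeze-avoidance probabilities under every conformal
equivalence `g : D → D'` with the right boundary values implies `P D' = Φ_* (P D)` for every continuous
`Φ : ℂ → ℂ` agreeing with `g` on `D` (`ChordalFamily.IsConformallyCovariant`). Proof plan: `Φ a = a'`,
`Φ b = b'` (boundary values, `a, b ∈ cl D`), so `Φ` is injective on `D ∪ {a, b} ⊇ range γ` and `Φ_* (P D)`
is a probability law on simple chords of `D'` meeting `∂D'` only at `a', b'`; for boundary-avoiding `γ`,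
`Φ ∘ γ ⊆ cl B' ⟺ range γ ∩ D ⊆ g⁻¹(cl B' ∩ D')`, so the two laws agree on every squeeze event; conclude
with the PROVED tree theorem `Summit.CriticalPhenomena.SAWScalingLimit.Theorems.AvoidanceDeterminesLaw.
AvoidanceDeterminesLaw_proof` (LSW03 Lemma 3.2 for simple chords of a Jordan domain). -/
theorem stub_squeezeCovariance :
    ∀ P : ChordalFamily, P.IsChordal →
      (∀ D : DobrushinDomain, ∀ᵐ γ ∂(P D),
        γ ∈ CurveClass.simple ∧ γ.range ∩ frontier D.carrier ⊆ {D.pt 0, D.pt 1}) →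
      (∀ (D D' : DobrushinDomain) (g : ConformalEquiv D.carrier D'.carrier),
        g.HasBoundaryValue (D.pt 0) (D'.pt 0) → g.HasBoundaryValue (D.pt 1) (D'.pt 1) →
          ∀ B' : DobrushinDomain, (B'.carrier ⊆ D'.carrier ∧ B'.pt 0 = D'.pt 0 ∧ B'.pt 1 = D'.pt 1 ∧
            (∃ ε : ℝ, 0 < ε ∧ B'.carrier ∩ Metric.ball (D'.pt 0) ε = D'.carrier ∩ Metric.ball (D'.pt 0) ε ∧
              B'.carrier ∩ Metric.ball (D'.pt 1) ε = D'.carrier ∩ Metric.ball (D'.pt 1) ε)) →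
            P D' (CurveClass.rangeSubset (closure B'.carrier)) =
              P D {γ | γ.range ∩ D.carrier ⊆ g.symm '' (closure B'.carrier ∩ D'.carrier)}) →
      P.IsConformallyCovariant := by
  sorry

/-! ### Consistency: each named statement IS its registered stub (definitionally) -/

theorem poissonGeneratorForm_holds : PoissonGeneratorForm := stub_poissonGenerator
theorem generatorRigidity_holds : GeneratorRigidity := stub_generatorRigidity
theorem squeezeCovariance_holds : SqueezeCovariance := stub_squeezeCovariance

/-! ### Name-keyed aliases of the three statements — the hypotheses of `PoissonRigidity_of`

The native skeleton audit (`#h21_check_skeleton`) admits a `Prop` hypothesis of the skeleton theorem only if its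
head constant is a registered obligation or is NAMED like a declared stub; `__Registered.stub_X` is the statement of
`stub_X` under that name (device of `Cruxes/AxiomsOfLimit/Lines/birth.lean`). Each alias is `rfl`-equal to the
type of the corresponding sorried stub (see the `*_holds` theorems above and the wiring `example` below). -/
namespace __Registered

/-- Alias of `PoissonGeneratorForm` keyed by the registered stub name. -/
abbrev stub_poissonGenerator : Prop := PoissonGeneratorForm
/-- Alias of `GeneratorRigidity` keyed by the registered stub name. -/
abbrev stub_generatorRigidity : Prop := GeneratorRigidity
/-- Alias of `SqueezeCovariance` keyed by the registered stub name. -/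
abbrev stub_squeezeCovariance : Prop := SqueezeCovariance

end __Registered

/-! ### The skeleton theorem: the three stubs imply the crux, BY NAME -/

/-- **`PoissonRigidity` from the line `birth`** (kernel-checked, no `sorry` of its own): given the crux's
eight hypotheses on `P`, S1 turns the alternation tower (viii) — with chordality (i) and simplicity (vii) —
into Poisson generators `ν` of both banks; S2 turns (i)–(vii) plus the generators into pull-back invariance
of the squeeze-avoidance probabilities under conformal equivalences; S3 turns that invariance (with (i),
(vii)) into `P.IsConformallyCovariant`. Hypotheses = the three stubs under their registered names;
conclusion = the route decl, by name. -/
theorem PoissonRigidity_of (hG : __Registered.stub_poissonGenerator)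
    (hR : __Registered.stub_generatorRigidity) (hC : __Registered.stub_squeezeCovariance) :
    Summit.CriticalPhenomena.SAWScalingLimit.Theses.SAWPoissonBanks.PoissonRigidity := by
  intro P hch hres hmk hrev hsim hconj hsimple htower
  -- S1: the tower of both banks, in generator form
  have hgen : ∃ ν : DobrushinDomain → Fin 2 → GermMeasure, IsPoissonGenerator P ν :=
    hG P hch hsimple htower
  -- S2: generators + the crux's symmetries ⇒ conformally invariant squeeze avoidance
  have hinv : SqueezeInvariant P := hR P hch hres hmk hrev hsim hconj hsimple hgen
  -- S3: squeeze-avoidance invariance ⇒ conformal covariance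
  exact hC P hch hsimple hinv

/-- Wiring check (an `example`, so that `PoissonRigidity_of` stays the only theorem concluding the crux): the
registered stubs, with their tree-vocabulary types, feed the skeleton theorem as stated — this term becomes
the crux proof when the three `sorry`s above are discharged. -/
example : Summit.CriticalPhenomena.SAWScalingLimit.Theses.SAWPoissonBanks.PoissonRigidity :=
  PoissonRigidity_of stub_poissonGenerator stub_generatorRigidity stub_squeezeCovariance

end Summit.CriticalPhenomena.SAWScalingLimit.Cruxes.PoissonRigidity.Birth

end
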